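import Mathlib
import HarnessLib
import Summits.KontsevichZagierPeriods.Zeta5Search.Denom.TwoTaleL720Levels
import Summits.KontsevichZagierPeriods.Zeta5Search.Denom.TwoTaleL720DigitTables
import Summits.KontsevichZagierPeriods.Zeta5Search.TwoTaleOmega.OmegaLadder

/-!
# TwoTaleL720Inclusion — the `InclusionL720` input of rung L(7/20) DISCHARGED: `Φₙ ∣ D₁₄₇ₙD₁₅₄ₙ qₙ`, `Φₙ⁻¹D₁₄₇ₙD₁₅₄ₙ pₙ ∈ ℤ`

HONEST FRAMING: systematic search; no irrationality claim unless certified.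

Cell pub-zeta5 (measure-opt g0), the L(7/20) twin of `Denom.TwoTaleL25Inclusion` / fam-denom's `Denom.TwoTaleD1Inclusion`; `p`-adic/denominator
bookkeeping only.  Rung L(7/20) of the two-tale ladder is Zudilin's construction [Zudilin2014ZetaTwo] at the cone point
`a = (127,107,87,147)·n + 1`, `b = (1, 20n+1, 40n+1, 254n+2)` with partner `â = (314n+2; 107n+1, 127n+1, 147n+1)`,
`b̂ = (147n+2; 60n+1, 234n+2, 254n+2)` (`TwoTaleL720Forms`).  Its saving product `Φₙ` (`TwoTaleL720Saving`, rate
`S ∈ [155.35326, 155.35341]`) counts the primes `362√n < p ≤ 147n` with digit `ν(n/p) = max(φ, φ̂) ≥ 1` (once) / `= 2`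
(twice).  This file proves the inclusion **hypothesis-free**:

* `bmissL720` — the two-tale coincidence `q(a,b) = −q̂(â,b̂)`, `p(a,b) = −p̂(â,b̂)` for every `n ≥ 1`: fam-tele's kernel
  theorem `TwoTaleOmega.bmiss_Lad` ((bmiss) on the whole ladder plane of the region `Ω`, cert-2's `bmiss_on_Omega`) at the
  ladder point `(Q,P) = (20n, 7n)`, transported to the `TwoTaleL720Forms` names;
* `levelsL720` — for every counted prime the level divisibilities `p^ℓ ∣ qₙ`, `p^ℓ ∣ D₁₄₇ₙD₁₅₄ₙ pₙ` from the CHECKED DIGIT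
  TABLES (`TwoTaleL720DigitTables.cover720_sound`: 181 cells, Lemma 7 / Lemma 8 row by row, `decide +kernel`);
* **`inclusionL720_holds : TwoTaleL720Exponent.InclusionL720`** via `TwoTaleL720Levels.inclusionL720_of_unpacked`;
* the rung's measure theorem with the inclusion discharged: **`zetaTwo_exponent_le_L720`** —
  `DecayL720 283.1134 → CoeffRateL720 C₁ → 0 < C₁ ≤ 406.88613 → (S-enclosure) → ExponentLE (zetaValue 2) 5.0194`.  The two remaining inputs
  (tale-1 decay `TwoTaleL720Decay`, coefficient growth `TwoTaleL720GrowthLimit`/`…Enclosure`) are assembled in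
  `TwoTaleL720Measure`; until then **5.0194 is a DESIGN value**, and in any case it concerns the known-irrational `ζ(2)`:
  nothing here bears on `ζ(5)`.  0 sorry; standard axioms.
References: W. Zudilin, arXiv:1310.1526 [Zudilin2014ZetaTwo], Lemmas 7–8, §5.
-/

namespace Summit.KontsevichZagierPeriods.Zeta5Search.Denom.TwoTaleL720Inclusion

open Literature.NumberTheory.Transcendental
open Literature.NumberTheory.Irrationality.Zudilin2014
open Summit.KontsevichZagierPeriods.Zeta5Search.Denom.TwoTaleL720Saving (ivl720 savingRate720)
open Summit.KontsevichZagierPeriods.Zeta5Search.Denom.TwoTaleL720Forms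
open Summit.KontsevichZagierPeriods.Zeta5Search.Denom.TwoTaleL720Exponent
open Summit.KontsevichZagierPeriods.Zeta5Search.Denom.TwoTaleL720Levels
open Summit.KontsevichZagierPeriods.Zeta5Search.Denom.TwoTaleL720DigitTables
open Summit.KontsevichZagierPeriods.Zeta5Search.TwoTaleOmega

/-! ### The two inputs of the level divisibilities -/

/-- The ladder point `Lad(20n, 7n)` has the L(7/20) tale data: `a = (127,107,87,147)·n+1`, `b = (1,20n+1,40n+1,254n+2)`,
`â = (314n+2;107n+1,127n+1,147n+1)`, `b̂ = (147n+2;60n+1,234n+2,254n+2)`. -/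
theorem Lad_L720_tales (n : ℕ) : (Pt.Lad (20 * (n : ℤ)) (7 * (n : ℤ))).t1a = aL720 n ∧
    (Pt.Lad (20 * (n : ℤ)) (7 * (n : ℤ))).t1b = bL720 n ∧ (Pt.Lad (20 * (n : ℤ)) (7 * (n : ℤ))).t2a = aTL720 n ∧
    (Pt.Lad (20 * (n : ℤ)) (7 * (n : ℤ))).t2b = bTL720 n := by
  refine ⟨?_, ?_, ?_, ?_⟩ <;> (ext i; fin_cases i <;> simp [Pt.t1a, Pt.t1b, Pt.t2a, Pt.t2b, Pt.Lad] <;> ring)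

/-- **(bmiss) at L(7/20)** in the `TwoTaleL720Forms` names: `q(a,b) = −q̂(â,b̂)` and `p(a,b) = −p̂(â,b̂)` for `n ≥ 1`
(fam-tele's `TwoTaleOmega.bmiss_Lad` at `(Q,P) = (20n,7n)`). -/
theorem bmissL720 {n : ℕ} (hn : 1 ≤ n) :
    formQ (aL720 n) (bL720 n) = -formQT (aTL720 n) (bTL720 n) ∧ formP (aL720 n) (bL720 n) = -formPT (aTL720 n) (bTL720 n) := by
  have h1 : (1 : ℤ) ≤ n := by exact_mod_cast hn
  have h := bmiss_Lad (20 * (n : ℤ)) (7 * (n : ℤ)) (by omega) (by omega)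
  obtain ⟨e1, e2, e3, e4⟩ := Lad_L720_tales n
  unfold Pt.Bmiss at h
  rw [e1, e2, e3, e4] at h
  exact h

/-- **`D₁₄₇ₙD₁₅₄ₙ pₙ` is the integer `formPZ (aL720 n) (bL720 n) (147n) (154n)`** (Prop. 1 with `M₁ = 147n ≥ aⱼ − bⱼ, b₄ − a₂* − 1`
and `M₂ = 154n ≥ d + 1, b₄ − a₂* − 1`). -/
theorem lcmNormaliserL720_mul_formPL720 {n : ℕ} (hn : 1 ≤ n) :
    ((lcmNormaliserL720 n : ℕ) : ℚ) * formPL720 n = (formPZ (aL720 n) (bL720 n) (147 * n) (154 * n) : ℚ) := by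
  have hc : ∀ j : Fin 4, j ≠ 3 → (aL720 n j - bL720 n j).toNat ≤ 147 * n := fun j hj => by
    have h := sideL720_M n j j hj
    rwa [aOne_slopeL720, bOne_betaL720] at h
  have hK := sideL720_K n
  have hd := sideL720_d hn
  rw [aOne_slopeL720, bOne_betaL720] at hK hd
  rw [lcmNormaliserL720, formPL720, Nat.cast_mul]
  exact formP_eq_cast (admissibleL720 hn) hc hK.1 hK.2 hd

/-! ### Level divisibilities from the digit tables -/

/-- **Level divisibilities at L(7/20)** (`n ≥ 1`): for a prime `p ≤ 147n` with `131044 n < p²` counted in `ivl720 i`,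
`p ∣ qₙ`, `p ∣ D₁₄₇ₙD₁₅₄ₙpₙ` (`i < 109`) and `p² ∣ qₙ`, `p² ∣ D₁₄₇ₙD₁₅₄ₙpₙ` (`109 ≤ i < 232`) — the digit tables
(`cover720_sound`) fed with (bmiss) (`bmissL720`). -/
theorem levelsL720 {n : ℕ} (hn : 1 ≤ n) :
    (∀ i < 109, ∀ p : ℕ, p.Prime → p ≤ 147 * n → 131044 * n < p ^ 2 →
      (ivl720 i).1 ≤ Int.fract ((n : ℝ) / p) → Int.fract ((n : ℝ) / p) < (ivl720 i).2 →
        (p : ℤ) ∣ formQZ (aL720 n) (bL720 n) ∧ (p : ℤ) ∣ formPZ (aL720 n) (bL720 n) (147 * n) (154 * n)) ∧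
    (∀ i, 109 ≤ i → i < 232 → ∀ p : ℕ, p.Prime → p ≤ 147 * n → 131044 * n < p ^ 2 →
      (ivl720 i).1 ≤ Int.fract ((n : ℝ) / p) → Int.fract ((n : ℝ) / p) < (ivl720 i).2 →
        (p : ℤ) ^ 2 ∣ formQZ (aL720 n) (bL720 n) ∧ (p : ℤ) ^ 2 ∣ formPZ (aL720 n) (bL720 n) (147 * n) (154 * n)) := by
  obtain ⟨hbq, hbp⟩ := bmissL720 hn
  refine ⟨fun i hi p hp hple hsq hu hv => ?_, fun i hi hi' p hp hple hsq hu hv => ?_⟩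
  · have h := cover720_sound (by omega) hn hp hple hsq hbq hbp hu hv
    rwa [if_pos hi, pow_one] at h
  · have h := cover720_sound hi' hn hp hple hsq hbq hbp hu hv
    rwa [if_neg (not_lt.2 hi)] at h

/-! ### The inclusion, hypothesis-free -/

/-- **`InclusionL720` holds**: `Φₙ ∣ D₁₄₇ₙD₁₅₄ₙ qₙ` and `Φₙ⁻¹ D₁₄₇ₙD₁₅₄ₙ pₙ ∈ ℤ` for every `n ≥ 1`. -/
theorem inclusionL720_holds : InclusionL720 :=
  inclusionL720_of_unpacked
    (fun _ hn => ⟨fun i hi p hp hple hsq hu hv => ((levelsL720 hn).1 i hi p hp hple hsq hu hv).1,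
      fun i hi hi' p hp hple hsq hu hv => ((levelsL720 hn).2 i hi hi' p hp hple hsq hu hv).1⟩)
    fun n hn => ⟨formPZ (aL720 n) (bL720 n) (147 * n) (154 * n), lcmNormaliserL720_mul_formPL720 hn,
      fun i hi p hp hple hsq hu hv => ((levelsL720 hn).1 i hi p hp hple hsq hu hv).2,
      fun i hi hi' p hp hple hsq hu hv => ((levelsL720 hn).2 i hi hi' p hp hple hsq hu hv).2⟩

/-! ### The rung's measure theorem with the inclusion discharged -/

/-- **Rung L(7/20) from the two tale-1 inputs (PROVED implication; `InclusionL720` discharged above):**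
`DecayL720 283.1134 → CoeffRateL720 C₁ → 0 < C₁ ≤ 406.88613 → (155.35326 ≤ S ≤ 155.35341) → μ(ζ(2)) ≤ 5.0194` (`ExponentLE`).  The inputs are the
tale-1 saddle theorems (`TwoTaleL720Decay`, `TwoTaleL720GrowthLimit` / `TwoTaleL720GrowthEnclosure`); 5.0194 stays a DESIGN
value until the capstone `TwoTaleL720Measure` lands; `ζ(2)` is known to be irrational — no claim about `ζ(5)`. -/
theorem zetaTwo_exponent_le_L720 {C₁ : ℝ} (hD : DecayL720 283.1134) (hC : CoeffRateL720 C₁) (hC₀ : 0 < C₁)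
    (hC₁ : C₁ ≤ 406.88613) (hS : (155.35326 : ℝ) ≤ savingRate720 ∧ savingRate720 ≤ 155.35341) :
    ExponentLE (zetaValue 2) 5.0194 :=
  zetaTwo_exponent_le_L720_of_inputs inclusionL720_holds hD hC hC₀ hC₁ hS

end Summit.KontsevichZagierPeriods.Zeta5Search.Denom.TwoTaleL720Inclusion
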